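import Summits.AtomisticToContinuum.HydrodynamicLimit.Theorems.EnskogAdjointDualityAdjointEnskogTestFamilyROperatorKappaOnePrep
import Summits.AtomisticToContinuum.HydrodynamicLimit.Theorems.EnskogAdjointDualityAdjointEnskogTestFamilyRPsiOneTorus
import Summits.AtomisticToContinuum.HydrodynamicLimit.Theorems.EnskogAdjointDualityDualityReductionLBound
import HarnessLib

/-!
# K2R refutation, stub `operatorKappaOne` — preparation 2: the spatial average of the corrector bracket

Route `EnskogAdjointDuality` of `AtomisticToContinuum/HydrodynamicLimit`, crux K2R `AdjointEnskogTestFamilyR`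
(stmt-AtomisticToContinuum-11592), line `refutation`, registered stub `stub_operatorKappaOne` (identity (I):
the corrector part `κ` of the test function against `ζ(s) sin(2πx₀) Θ₁^R(v)`).  The spatial profile is
integrated out FIRST: with the torus averages `κ_s(U) = ∫ sin(2πx₀) κ(x, U) dx`, `κ_c(U) = ∫ cos(2πx₀) κ(x, U) dx`
(`k2r_ref_ok1_avg`) and the Haar shift of the sine profile (`k2r_ref_p1_integral_sin_mul_translate`), the
`x`-integral of the test-side hard-sphere bracket `L_κ(x, v)` against `sin(2πx₀)` is the bracket of
`stub_kappaOperator` for the pair `g₁ = κ_s`, `g₂(ω, U) = cos(kω₀) κ_s(U) − sin(kω₀) κ_c(U)`, `k = 2πε`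
(`k2r_ref_ok1_x_integral`: Fubini on `𝕋³ × (S² × ℝ³)` by Gaussian domination; registered keyed sub-goal
`stub_operatorKappaOne_prep2` = the domination arithmetic `(a + b)(1 + b²) ≤ (1 + a)(1 + b)³`).  Finally
`k2r_ref_ok1_B_le`: `∫_{S²} ∫ (1+|U|²) I₀^R(U, ω) dU dσ ≤ 32π² J_R + 1760π` for the master function of
`k2r_ref_ok0_integrable_SV` (the exchange `k2r_ref_ok0_triple` read backwards, energy conservation, the
flux-moment budget `∫∫ q₊ M (1+|w|²) ≤ 4π(4|v|+9)` and the moments of `Θ₀^R`).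

References: C. Cercignani, R. Illner, M. Pulvirenti, *The Mathematical Theory of Dilute Gases* (1994),
§3.1, §7.2 [CIP1994].
-/

noncomputable section

open MeasureTheory Set Filter Function
open scoped InnerProductSpace Real

namespace Summit.AtomisticToContinuum.HydrodynamicLimit.Theorems.EnskogAdjointDuality

open Literature.MathematicalPhysics.KineticTheory Literature.Analysis.FluidPDE Literature.Analysis.FunctionSpaces
open Literature.Analysis.UnboundedOperators (collisionFrequency)

/-! ## Torus averages of the corrector -/
/-- **Torus averages of the corrector.** For a jointly continuous `κ` with `|κ(x, U)| ≤ C(1+|U|²)` and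
a continuous profile `|c| ≤ 1` on `𝕋³`, the average `κ_c(U) = ∫ c(x) κ(x, U) dx` (pinned by its defining
equation) is continuous with `|κ_c(U)| ≤ C(1+|U|²)` (parametric integral over the compact torus of
mass one). [folklore] -/
theorem k2r_ref_ok1_avg {κ : T3 → V3 → ℝ} (hκ : Continuous (uncurry κ)) {C : ℝ}
    (hκb : ∀ x v, |κ x v| ≤ C * (1 + ‖v‖ ^ 2)) {c : T3 → ℝ} (hc : Continuous c) (hc1 : ∀ x, |c x| ≤ 1)
    {κa : V3 → ℝ} (hκa : ∀ U, κa U = ∫ x : T3, c x * κ x U) :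
    Continuous κa ∧ ∀ U, |κa U| ≤ C * (1 + ‖U‖ ^ 2) := by
  have hC : 0 ≤ C := by
    have h := hκb 0 0
    rw [norm_zero] at h
    nlinarith [abs_nonneg (κ 0 0)]
  have hF : Continuous (uncurry fun (U : V3) (x : T3) => c x * κ x U) :=
    (hc.comp continuous_snd).mul (hκ.comp (continuous_snd.prodMk continuous_fst))
  have hcont := continuous_parametric_integral_of_continuous (μ := (volume : Measure T3)) hF
    isCompact_univ
  simp only [Measure.restrict_univ] at hcont
  have heq : κa = fun U => ∫ x : T3, c x * κ x U := funext hκa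
  refine ⟨heq ▸ hcont, fun U => ?_⟩
  rw [hκa U]
  have h := norm_integral_le_of_norm_le_const (μ := (volume : Measure T3))
    (f := fun x : T3 => c x * κ x U) (C := C * (1 + ‖U‖ ^ 2)) (Eventually.of_forall fun x => by
      rw [norm_mul, Real.norm_eq_abs, Real.norm_eq_abs]
      calc |c x| * |κ x U| ≤ 1 * (C * (1 + ‖U‖ ^ 2)) :=
            mul_le_mul (hc1 x) (hκb x U) (abs_nonneg _) zero_le_one
        _ = _ := one_mul _)
  rwa [probReal_univ, mul_one, Real.norm_eq_abs] at h

/-! ## The spatial average of the corrector bracket -/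

/-- The weight arithmetic `(a + b)(1 + b²) ≤ (1 + a)(1 + b)³` for `a, b ≥ 0`. [folklore] -/
theorem k2r_ref_ok1_weight_le {a b : ℝ} (ha : 0 ≤ a) (hb : 0 ≤ b) :
    (a + b) * (1 + b ^ 2) ≤ (1 + a) * (1 + b) ^ 3 := by
  nlinarith [mul_nonneg ha hb, mul_nonneg (mul_nonneg ha hb) hb, sq_nonneg b, mul_nonneg ha (sq_nonneg b)]

/-- **Registered keyed sub-goal `stub_operatorKappaOne_prep2`** of stub `operatorKappaOne` (line
`refutation` of crux K2R `AdjointEnskogTestFamilyR`): the weight arithmetic behind the Gaussian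
domination of the corrector bracket on `𝕋³ × S² × ℝ³`. [folklore] -/
theorem stub_operatorKappaOne_prep2 : ∀ a b : ℝ, 0 ≤ a → 0 ≤ b → (a + b) * (1 + b ^ 2) ≤ (1 + a) * (1 + b) ^ 3 :=
  fun _ _ ha hb => k2r_ref_ok1_weight_le ha hb

/-- **Gaussian domination of the corrector bracket.** For `|κ(x, U)| ≤ C(1+|U|²)`, a profile `|c| ≤ 1`,
a unit `ω` and all `x, y`:
`|c(x) q₊ Y₀ ρ₀ M(w) [κ(x,v') + κ(y,w') − κ(x,v) − κ(y,w)]| ≤ 18 C |Y₀ρ₀| (1+|v|²)(1+|v|) · (1+|w|)³ M(w)`.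
[folklore] -/
theorem k2r_ref_ok1_bracket_dom {κ : T3 → V3 → ℝ} {C : ℝ} (hκb : ∀ x v, |κ x v| ≤ C * (1 + ‖v‖ ^ 2))
    (Y₀ ρ₀ : ℝ) {cx : ℝ} (hcx : |cx| ≤ 1) (x y : T3) (v w : V3) (ω : Metric.sphere (0 : V3) 1) :
    |cx * (max ⟪v - w, (ω : V3)⟫_ℝ 0 * Y₀ * (ρ₀ * globalMaxwellian w) *
      (κ x (v - ⟪v - w, (ω : V3)⟫_ℝ • (ω : V3)) + κ y (w + ⟪v - w, (ω : V3)⟫_ℝ • (ω : V3)) -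
        κ x v - κ y w))| ≤
      18 * C * |Y₀ * ρ₀| * ((1 + ‖v‖ ^ 2) * (1 + ‖v‖)) * ((1 + ‖w‖) ^ 3 * globalMaxwellian w) := by
  have hC : 0 ≤ C := by
    have h := hκb x 0
    rw [norm_zero] at h
    nlinarith [abs_nonneg (κ x 0)]
  have hinc := abs_increment_le (φ := κ) hκb x y v w ω
  have hq := k2r_ref_ko_pos_le v w ω
  have hq0 : 0 ≤ max ⟪v - w, (ω : V3)⟫_ℝ 0 := le_max_right _ _
  have hM : 0 ≤ globalMaxwellian w := (globalMaxwellian_pos w).le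
  have hwt := k2r_ref_ok1_weight_le (norm_nonneg v) (norm_nonneg w)
  rw [abs_mul, abs_mul, abs_mul, abs_mul, abs_mul, abs_of_nonneg hq0, abs_of_nonneg hM]
  calc |cx| * (max ⟪v - w, (ω : V3)⟫_ℝ 0 * |Y₀| * (|ρ₀| * globalMaxwellian w) *
        |κ x (v - ⟪v - w, (ω : V3)⟫_ℝ • (ω : V3)) + κ y (w + ⟪v - w, (ω : V3)⟫_ℝ • (ω : V3)) -
          κ x v - κ y w|)
      ≤ 1 * ((‖v‖ + ‖w‖) * |Y₀| * (|ρ₀| * globalMaxwellian w) *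
          (18 * C * ((1 + ‖v‖ ^ 2) * (1 + ‖w‖ ^ 2)))) := by gcongr
    _ = 18 * C * (|Y₀| * |ρ₀|) * (1 + ‖v‖ ^ 2) * (((‖v‖ + ‖w‖) * (1 + ‖w‖ ^ 2)) * globalMaxwellian w) := by
        ring
    _ ≤ 18 * C * (|Y₀| * |ρ₀|) * (1 + ‖v‖ ^ 2) * (((1 + ‖v‖) * (1 + ‖w‖) ^ 3) * globalMaxwellian w) := by
        gcongr
    _ = _ := by rw [← abs_mul]; ring


/-- **The spatial average of the corrector bracket.** For a jointly continuous corrector `κ` with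
`|κ(x, U)| ≤ C(1+|U|²)`, its torus averages `κ_s, κ_c` against `sin(2πx₀), cos(2πx₀)`, and the
test-side hard-sphere bracket `L_κ` at the constant background (`Y₀`, `ρ₀`, Maxwellian `M`, shift
`x⁺ = x + εω`):
`∫ sin(2πx₀) L_κ(x, v) dx = Y₀ρ₀ (∫∫ q₊ M κ_s(w') + ∫∫ q₊ M g₂(ω, w') − ν(v) κ_s(v) − ∫∫ q₊ M g₂(ω, w))`,
`g₂(ω, U) = cos(kω₀) κ_s(U) − sin(kω₀) κ_c(U)`, `k = 2πε`, `ν = collisionFrequency`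
(Fubini on `𝕋³ × (S² × ℝ³)` by Gaussian domination, the Haar shift of the sine profile, and the
gain/loss decomposition `stub_kappaOperator` for the pair `(κ_s, g₂)`). [cite: CIP1994, §3.1] -/
theorem k2r_ref_ok1_x_integral {Y₀ ρ₀ ε C : ℝ} {κ : T3 → V3 → ℝ} (hκ : Continuous (uncurry κ))
    (hκb : ∀ x v, |κ x v| ≤ C * (1 + ‖v‖ ^ 2))
    {κs κc : V3 → ℝ} (hκs : ∀ U, κs U = ∫ x : T3, Torus.sinCoord 0 x * κ x U)
    (hκc : ∀ U, κc U = ∫ x : T3, Torus.cosCoord 0 x * κ x U)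
    (Lκ : T3 → V3 → ℝ)
    (hLκ : ∀ x v, Lκ x v = ∫ ω : Metric.sphere (0 : V3) 1, (∫ w : V3,
      max ⟪v - w, (ω : V3)⟫_ℝ 0 * Y₀ * (ρ₀ * globalMaxwellian w) *
        (κ x (v - ⟪v - w, (ω : V3)⟫_ℝ • (ω : V3)) +
          κ (x + Torus.proj (ε • (ω : V3))) (w + ⟪v - w, (ω : V3)⟫_ℝ • (ω : V3)) -
          κ x v - κ (x + Torus.proj (ε • (ω : V3))) w)) ∂sphereMeasure)
    (v : V3) :
    ∫ x : T3, Torus.sinCoord 0 x * Lκ x v =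
      Y₀ * ρ₀ * ((∫ p : Metric.sphere (0 : V3) 1 × V3,
          max ⟪v - p.2, (p.1 : V3)⟫_ℝ 0 * globalMaxwellian p.2 *
            κs (p.2 + ⟪v - p.2, (p.1 : V3)⟫_ℝ • (p.1 : V3))
          ∂((sphereMeasure : Measure (Metric.sphere (0 : V3) 1)).prod volume)) +
        (∫ p : Metric.sphere (0 : V3) 1 × V3,
          max ⟪v - p.2, (p.1 : V3)⟫_ℝ 0 * globalMaxwellian p.2 *
            (Real.cos (2 * Real.pi * ε * (p.1 : V3) 0) * κs (p.2 + ⟪v - p.2, (p.1 : V3)⟫_ℝ • (p.1 : V3)) -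
              Real.sin (2 * Real.pi * ε * (p.1 : V3) 0) * κc (p.2 + ⟪v - p.2, (p.1 : V3)⟫_ℝ • (p.1 : V3)))
          ∂((sphereMeasure : Measure (Metric.sphere (0 : V3) 1)).prod volume)) -
        collisionFrequency v * κs v -
        (∫ p : Metric.sphere (0 : V3) 1 × V3,
          max ⟪v - p.2, (p.1 : V3)⟫_ℝ 0 * globalMaxwellian p.2 *
            (Real.cos (2 * Real.pi * ε * (p.1 : V3) 0) * κs p.2 -
              Real.sin (2 * Real.pi * ε * (p.1 : V3) 0) * κc p.2)
          ∂((sphereMeasure : Measure (Metric.sphere (0 : V3) 1)).prod volume))) := by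
  haveI := isFiniteMeasure_sphereMeasure (E := V3)
  have hC : 0 ≤ C := by
    have h := hκb 0 0
    rw [norm_zero] at h
    nlinarith [abs_nonneg (κ 0 0)]
  have hsin : Continuous (Torus.sinCoord (0 : Fin 3) : T3 → ℝ) := (Torus.isSmooth_sinCoord 0).continuous
  have hcos : Continuous (Torus.cosCoord (0 : Fin 3) : T3 → ℝ) := (Torus.isSmooth_cosCoord 0).continuous
  have hsin1 : ∀ x : T3, |Torus.sinCoord 0 x| ≤ 1 := fun x => by
    obtain ⟨t, ht⟩ := Torus.exists_coe_eq (x 0)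
    rw [Torus.sinCoord_of_eq ht.symm]
    exact Real.abs_sin_le_one _
  obtain ⟨hκsc, hκsb⟩ := k2r_ref_ok1_avg hκ hκb hsin hsin1 hκs
  obtain ⟨hκcc, hκcb⟩ := k2r_ref_ok1_avg hκ hκb hcos (Torus.abs_cosCoord_le 0) hκc
  have hκ' : ∀ {X : Type} [TopologicalSpace X] {f : X → T3} {g : X → V3},
      Continuous f → Continuous g → Continuous fun x => κ (f x) (g x) :=
    fun hf hg => hκ.comp (hf.prodMk hg)
  have hM := continuous_globalMaxwellian (E := V3)
  have hpr := Torus.continuous_proj (d := Fin 3)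
  -- the bracket integrand `B(x, p)` on `𝕋³ × (S² × ℝ³)` and the averaged pair `(g₁, g₂) = (κ_s, g₂)`
  obtain ⟨B, hB⟩ : ∃ B : T3 → Metric.sphere (0 : V3) 1 × V3 → ℝ, ∀ x p, B x p =
      max ⟪v - p.2, (p.1 : V3)⟫_ℝ 0 * Y₀ * (ρ₀ * globalMaxwellian p.2) *
        (κ x (v - ⟪v - p.2, (p.1 : V3)⟫_ℝ • (p.1 : V3)) +
          κ (x + Torus.proj (ε • (p.1 : V3))) (p.2 + ⟪v - p.2, (p.1 : V3)⟫_ℝ • (p.1 : V3)) -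
          κ x v - κ (x + Torus.proj (ε • (p.1 : V3))) p.2) := ⟨_, fun _ _ => rfl⟩
  obtain ⟨g₂, hg₂⟩ : ∃ g₂ : Metric.sphere (0 : V3) 1 × V3 → ℝ, ∀ r, g₂ r =
      Real.cos (2 * Real.pi * ε * (r.1 : V3) 0) * κs r.2 - Real.sin (2 * Real.pi * ε * (r.1 : V3) 0) * κc r.2 :=
    ⟨_, fun _ => rfl⟩
  have hBf : B = fun x p => max ⟪v - p.2, (p.1 : V3)⟫_ℝ 0 * Y₀ * (ρ₀ * globalMaxwellian p.2) *
        (κ x (v - ⟪v - p.2, (p.1 : V3)⟫_ℝ • (p.1 : V3)) +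
          κ (x + Torus.proj (ε • (p.1 : V3))) (p.2 + ⟪v - p.2, (p.1 : V3)⟫_ℝ • (p.1 : V3)) -
          κ x v - κ (x + Torus.proj (ε • (p.1 : V3))) p.2) := funext fun x => funext (hB x)
  have hg₂f : g₂ = fun r : Metric.sphere (0 : V3) 1 × V3 =>
      Real.cos (2 * Real.pi * ε * (r.1 : V3) 0) * κs r.2 - Real.sin (2 * Real.pi * ε * (r.1 : V3) 0) * κc r.2 :=
    funext hg₂
  have hg₂c : Continuous g₂ := by
    rw [hg₂f]
    fun_prop
  have hg₂b : ∀ (ω : Metric.sphere (0 : V3) 1) (u : V3), |g₂ (ω, u)| ≤ 2 * C * (1 + ‖u‖ ^ 2) := by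
    intro ω u
    rw [hg₂]
    have h1 : |Real.cos (2 * Real.pi * ε * (ω : V3) 0) * κs u| ≤ C * (1 + ‖u‖ ^ 2) := by
      rw [abs_mul]
      calc |Real.cos (2 * Real.pi * ε * (ω : V3) 0)| * |κs u| ≤ 1 * (C * (1 + ‖u‖ ^ 2)) :=
            mul_le_mul (Real.abs_cos_le_one _) (hκsb u) (abs_nonneg _) zero_le_one
        _ = _ := one_mul _
    have h2 : |Real.sin (2 * Real.pi * ε * (ω : V3) 0) * κc u| ≤ C * (1 + ‖u‖ ^ 2) := by
      rw [abs_mul]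
      calc |Real.sin (2 * Real.pi * ε * (ω : V3) 0)| * |κc u| ≤ 1 * (C * (1 + ‖u‖ ^ 2)) :=
            mul_le_mul (Real.abs_sin_le_one _) (hκcb u) (abs_nonneg _) zero_le_one
        _ = _ := one_mul _
    calc _ ≤ |Real.cos (2 * Real.pi * ε * (ω : V3) 0) * κs u| +
          |Real.sin (2 * Real.pi * ε * (ω : V3) 0) * κc u| := abs_sub _ _
      _ ≤ C * (1 + ‖u‖ ^ 2) + C * (1 + ‖u‖ ^ 2) := add_le_add h1 h2
      _ = 2 * C * (1 + ‖u‖ ^ 2) := by ring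
  have hg₁b : ∀ u : V3, |κs u| ≤ 2 * C * (1 + ‖u‖ ^ 2) := fun u =>
    (hκsb u).trans (by nlinarith [sq_nonneg ‖u‖])
  -- Gaussian domination
  have hG : Integrable (fun w : V3 => (1 + ‖w‖) ^ 3 * globalMaxwellian w) :=
    Literature.Analysis.UnboundedOperators.integrable_one_add_norm_pow_mul_globalMaxwellian 3
  set Kv : ℝ := 18 * C * |Y₀ * ρ₀| * ((1 + ‖v‖ ^ 2) * (1 + ‖v‖)) with hKv
  have hdomB : ∀ (x : T3) (p : Metric.sphere (0 : V3) 1 × V3) {cx : ℝ}, |cx| ≤ 1 →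
      |cx * B x p| ≤ Kv * ((1 + ‖p.2‖) ^ 3 * globalMaxwellian p.2) := fun x p cx hcx => by
    rw [hB]
    exact k2r_ref_ok1_bracket_dom hκb Y₀ ρ₀ hcx x (x + Torus.proj (ε • (p.1 : V3))) v p.2 p.1
  have hBx : ∀ x : T3, Integrable (B x) ((sphereMeasure : Measure (Metric.sphere (0 : V3) 1)).prod volume) := by
    intro x
    refine k2r_ref_ko_integrable_of_le (K := Kv) (n := 3) (by rw [hBf]; fun_prop) fun p => ?_
    have h := hdomB x p (cx := 1) (by rw [abs_one])
    rwa [one_mul] at h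
  have hSBc : Continuous fun q : T3 × (Metric.sphere (0 : V3) 1 × V3) => Torus.sinCoord 0 q.1 * B q.1 q.2 := by
    rw [hBf]
    fun_prop
  have hSB : Integrable (fun q : T3 × (Metric.sphere (0 : V3) 1 × V3) => Torus.sinCoord 0 q.1 * B q.1 q.2)
      ((volume : Measure T3).prod ((sphereMeasure : Measure (Metric.sphere (0 : V3) 1)).prod volume)) := by
    refine (((hG.comp_snd (sphereMeasure : Measure (Metric.sphere (0 : V3) 1))).const_mul Kv).comp_snd
      (volume : Measure T3)).mono' hSBc.aestronglyMeasurable (Eventually.of_forall fun q => ?_)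
    rw [Real.norm_eq_abs]
    exact hdomB q.1 q.2 (hsin1 q.1)
  -- the `x`-integral of the bracket, pointwise in `(ω, w)`
  have hxint : ∀ p : Metric.sphere (0 : V3) 1 × V3, ∫ x : T3, Torus.sinCoord 0 x * B x p =
      max ⟪v - p.2, (p.1 : V3)⟫_ℝ 0 * Y₀ * (ρ₀ * globalMaxwellian p.2) *
        (κs (v - ⟪v - p.2, (p.1 : V3)⟫_ℝ • (p.1 : V3)) + g₂ (p.1, p.2 + ⟪v - p.2, (p.1 : V3)⟫_ℝ • (p.1 : V3)) -
          κs v - g₂ (p.1, p.2)) := by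
    rintro ⟨ω, w⟩
    set v' : V3 := v - ⟪v - w, (ω : V3)⟫_ℝ • (ω : V3) with hv'
    set w' : V3 := w + ⟪v - w, (ω : V3)⟫_ℝ • (ω : V3) with hw'
    set A : ℝ := max ⟪v - w, (ω : V3)⟫_ℝ 0 * Y₀ * (ρ₀ * globalMaxwellian w) with hA
    have i1 : Integrable (fun x : T3 => Torus.sinCoord 0 x * κ x v') :=
      (hsin.mul (hκ' continuous_id continuous_const)).integrable_unitAddTorus
    have i2 : Integrable (fun x : T3 => Torus.sinCoord 0 x * κ (x + Torus.proj (ε • (ω : V3))) w') :=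
      (hsin.mul (hκ' (continuous_id.add continuous_const) continuous_const)).integrable_unitAddTorus
    have i3 : Integrable (fun x : T3 => Torus.sinCoord 0 x * κ x v) :=
      (hsin.mul (hκ' continuous_id continuous_const)).integrable_unitAddTorus
    have i4 : Integrable (fun x : T3 => Torus.sinCoord 0 x * κ (x + Torus.proj (ε • (ω : V3))) w) :=
      (hsin.mul (hκ' (continuous_id.add continuous_const) continuous_const)).integrable_unitAddTorus
    have i12 : Integrable (fun x : T3 => Torus.sinCoord 0 x * κ x v' +
        Torus.sinCoord 0 x * κ (x + Torus.proj (ε • (ω : V3))) w') := i1.add i2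
    have i123 : Integrable (fun x : T3 => Torus.sinCoord 0 x * κ x v' +
        Torus.sinCoord 0 x * κ (x + Torus.proj (ε • (ω : V3))) w' - Torus.sinCoord 0 x * κ x v) := i12.sub i3
    have ht2 := k2r_ref_p1_integral_sin_mul_translate (γ := fun x => κ x w') (hκ' continuous_id continuous_const) ε ω
    have ht4 := k2r_ref_p1_integral_sin_mul_translate (γ := fun x => κ x w) (hκ' continuous_id continuous_const) ε ω
    have e : ∀ x : T3, Torus.sinCoord 0 x * B x (ω, w) =
        A * (Torus.sinCoord 0 x * κ x v' + Torus.sinCoord 0 x * κ (x + Torus.proj (ε • (ω : V3))) w' -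
          Torus.sinCoord 0 x * κ x v - Torus.sinCoord 0 x * κ (x + Torus.proj (ε • (ω : V3))) w) := fun x => by
      rw [hB]
      ring
    simp_rw [e]
    rw [integral_const_mul, integral_sub i123 i4, integral_sub i12 i3,
      integral_add i1 i2, ht2, ht4, ← hκs v', ← hκs w', ← hκc w', ← hκs v, ← hκs w, ← hκc w, hg₂, hg₂]
  -- the averaged bracket is integrable on `σ ⊗ dw` (a marginal of the dominated triple integrand)
  have hF' : Integrable (fun p : Metric.sphere (0 : V3) 1 × V3 =>
      max ⟪v - p.2, (p.1 : V3)⟫_ℝ 0 * Y₀ * (ρ₀ * globalMaxwellian p.2) *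
        (κs (v - ⟪v - p.2, (p.1 : V3)⟫_ℝ • (p.1 : V3)) + g₂ (p.1, p.2 + ⟪v - p.2, (p.1 : V3)⟫_ℝ • (p.1 : V3)) -
          κs v - g₂ (p.1, p.2)))
      ((sphereMeasure : Measure (Metric.sphere (0 : V3) 1)).prod volume) :=
    hSB.integral_prod_right.congr (Eventually.of_forall hxint)
  -- the gain/loss decomposition for the averaged pair
  have hKO := (stub_kappaOperator Y₀ ρ₀ (2 * C) κs g₂ hκsc hg₂c hg₁b hg₂b v).2.2.2.2.2
  calc ∫ x : T3, Torus.sinCoord 0 x * Lκ x v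
      = ∫ x : T3, Torus.sinCoord 0 x * ∫ p, B x p
          ∂((sphereMeasure : Measure (Metric.sphere (0 : V3) 1)).prod volume) := by
        refine integral_congr_ae (Eventually.of_forall fun x => ?_)
        dsimp only
        rw [hLκ x v, integral_prod _ (hBx x)]
        simp only [hB]
    _ = ∫ x : T3, ∫ p, Torus.sinCoord 0 x * B x p
          ∂((sphereMeasure : Measure (Metric.sphere (0 : V3) 1)).prod volume) :=
        integral_congr_ae (Eventually.of_forall fun x => (integral_const_mul _ _).symm)
    _ = ∫ p, (∫ x : T3, Torus.sinCoord 0 x * B x p)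
          ∂((sphereMeasure : Measure (Metric.sphere (0 : V3) 1)).prod volume) :=
        integral_integral_swap hSB
    _ = ∫ p : Metric.sphere (0 : V3) 1 × V3,
          max ⟪v - p.2, (p.1 : V3)⟫_ℝ 0 * Y₀ * (ρ₀ * globalMaxwellian p.2) *
            (κs (v - ⟪v - p.2, (p.1 : V3)⟫_ℝ • (p.1 : V3)) + g₂ (p.1, p.2 + ⟪v - p.2, (p.1 : V3)⟫_ℝ • (p.1 : V3)) -
              κs v - g₂ (p.1, p.2))
          ∂((sphereMeasure : Measure (Metric.sphere (0 : V3) 1)).prod volume) :=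
        integral_congr_ae (Eventually.of_forall hxint)
    _ = ∫ ω : Metric.sphere (0 : V3) 1, (∫ w : V3,
          max ⟪v - w, (ω : V3)⟫_ℝ 0 * Y₀ * (ρ₀ * globalMaxwellian w) *
            (κs (v - ⟪v - w, (ω : V3)⟫_ℝ • (ω : V3)) + g₂ (ω, w + ⟪v - w, (ω : V3)⟫_ℝ • (ω : V3)) -
              κs v - g₂ (ω, w))) ∂sphereMeasure := integral_prod _ hF'
    _ = _ := by
        rw [hKO]
        simp only [hg₂]

/-! ## The sphere integral of the master function -/

variable {Θ₀ : ℝ → V3 → ℝ} {I₀ : ℝ → V3 → V3 → ℝ}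
variable (hΘ₀ : ∀ R v, Θ₀ R v = ((1 + ‖v‖ ^ 2) ^ 3)⁻¹ * Real.exp (-‖v‖ ^ 2 / R))
  (hI₀ : ∀ R U n, I₀ R U n = (1 / 2 : ℝ) * Real.exp (-(‖U‖ ^ 2 - ⟪U, n⟫_ℝ ^ 2) / 2) *
    (∫ b, max (⟪U, n⟫_ℝ - b) 0 * (Real.exp (-b ^ 2 / 2) / Real.sqrt (2 * π))) *
    ∫ E in Ioi (⟪U, n⟫_ℝ ^ 2), ((1 + E) ^ 3)⁻¹ * Real.exp (-E / R))
include hΘ₀ hI₀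

/-- **The sphere integral of the master function.** `b(ω) = ∫ (1+|U|²) I₀^R(U, ω) dU` is
`σ`-integrable, nonnegative, and `∫_{S²} b dσ ≤ 32π² J_R + 1760π`, `J_R = ∫₀^∞ E²(1+E)⁻³e^{-E/R}`:
the exchange `k2r_ref_ok0_triple` read backwards gives `∫ b dσ = ∫ Θ₀^R(v) ∫∫ q₊ M (1+|w'|²)`, then
`1 + |w'|² ≤ (1+|v|²)(1+|w|²)`, the flux-moment budget `∫∫ q₊ M (1+|w|²) ≤ 4π(4|v|+9)` and the moments
`∫ |v|^k Θ₀^R ≤ 20` (`k ≤ 2`), `∫ |v|³ Θ₀^R = 2πJ_R`. [cite: CIP1994, §7.2 (2.13)] -/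
theorem k2r_ref_ok1_B_le {R : ℝ} (hR : 1 ≤ R) :
    Integrable (fun ω : Metric.sphere (0 : V3) 1 => ∫ U : V3, (1 + ‖U‖ ^ 2) * I₀ R U ω)
      (sphereMeasure : Measure (Metric.sphere (0 : V3) 1)) ∧
    (∀ ω : Metric.sphere (0 : V3) 1, 0 ≤ ∫ U : V3, (1 + ‖U‖ ^ 2) * I₀ R U ω) ∧
    ∫ ω : Metric.sphere (0 : V3) 1, (∫ U : V3, (1 + ‖U‖ ^ 2) * I₀ R U ω) ∂sphereMeasure ≤
      32 * Real.pi ^ 2 * (∫ E in Ioi (0 : ℝ), E ^ 2 * (((1 + E) ^ 3)⁻¹ * Real.exp (-E / R))) +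
        1760 * Real.pi := by
  haveI := isFiniteMeasure_sphereMeasure (E := V3)
  have hM := k2r_ref_ok0_integrable_SV hΘ₀ hI₀ hR
  refine ⟨hM.integral_prod_left, fun ω => (k2r_ref_ok0_Q_le hΘ₀ hI₀ hR ω).2.1, ?_⟩
  -- the exchange read backwards
  have hb1 : ∀ U : V3, |1 + ‖U‖ ^ 2| ≤ 1 * (1 + ‖U‖ ^ 2) := fun U => by
    rw [abs_of_nonneg (by positivity), one_mul]
  obtain ⟨hint, heq⟩ := k2r_ref_ok0_triple hΘ₀ hI₀ hR
    (K := fun (_ : Metric.sphere (0 : V3) 1) (U : V3) => 1 + ‖U‖ ^ 2) (by fun_prop) (CK := 1)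
    (fun _ U => hb1 U)
  rw [← heq]
  -- the flux budget per velocity
  have hflux : ∀ v : V3, ∫ p : Metric.sphere (0 : V3) 1 × V3,
      max ⟪v - p.2, (p.1 : V3)⟫_ℝ 0 * globalMaxwellian p.2 *
        (1 + ‖p.2 + ⟪v - p.2, (p.1 : V3)⟫_ℝ • (p.1 : V3)‖ ^ 2)
      ∂((sphereMeasure : Measure (Metric.sphere (0 : V3) 1)).prod volume) ≤
      (1 + ‖v‖ ^ 2) * (4 * Real.pi * (4 * ‖v‖ + 9)) := by
    intro v
    have hf : Integrable (fun p : Metric.sphere (0 : V3) 1 × V3 =>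
        max ⟪v - p.2, (p.1 : V3)⟫_ℝ 0 * globalMaxwellian p.2 *
          (1 + ‖p.2 + ⟪v - p.2, (p.1 : V3)⟫_ℝ • (p.1 : V3)‖ ^ 2))
        ((sphereMeasure : Measure (Metric.sphere (0 : V3) 1)).prod volume) :=
      k2r_ref_ko_integrable_piece (G := fun p => 1 + ‖p.2 + ⟪v - p.2, (p.1 : V3)⟫_ℝ • (p.1 : V3)‖ ^ 2)
        (by fun_prop) zero_le_one v fun p => by
          rw [abs_of_nonneg (by positivity), one_mul]
          linarith [(k2r_ref_ko_norm_sq_out_le v p.2 p.1).2]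
    have hg : Integrable (fun p : Metric.sphere (0 : V3) 1 × V3 =>
        max ⟪v - p.2, (p.1 : V3)⟫_ℝ 0 * globalMaxwellian p.2 * (1 + ‖p.2‖ ^ 2))
        ((sphereMeasure : Measure (Metric.sphere (0 : V3) 1)).prod volume) :=
      k2r_ref_ko_integrable_piece (G := fun p => 1 + ‖p.2‖ ^ 2) (by fun_prop) zero_le_one v fun p => by
        rw [abs_of_nonneg (by positivity), one_mul]; nlinarith [sq_nonneg ‖v‖]
    have hbud := k2r_ref_ko_flux_moment_le v hg
    calc ∫ p : Metric.sphere (0 : V3) 1 × V3, max ⟪v - p.2, (p.1 : V3)⟫_ℝ 0 * globalMaxwellian p.2 *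
          (1 + ‖p.2 + ⟪v - p.2, (p.1 : V3)⟫_ℝ • (p.1 : V3)‖ ^ 2)
          ∂((sphereMeasure : Measure (Metric.sphere (0 : V3) 1)).prod volume)
        ≤ ∫ p : Metric.sphere (0 : V3) 1 × V3, (1 + ‖v‖ ^ 2) *
            (max ⟪v - p.2, (p.1 : V3)⟫_ℝ 0 * globalMaxwellian p.2 * (1 + ‖p.2‖ ^ 2))
          ∂((sphereMeasure : Measure (Metric.sphere (0 : V3) 1)).prod volume) := by
          refine integral_mono hf (hg.const_mul _) fun p => ?_
          have hq0 : 0 ≤ max ⟪v - p.2, (p.1 : V3)⟫_ℝ 0 * globalMaxwellian p.2 :=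
            mul_nonneg (le_max_right _ _) (globalMaxwellian_pos p.2).le
          have he := (k2r_ref_ko_norm_sq_out_le v p.2 p.1).2
          have h2 : 1 + ‖p.2 + ⟪v - p.2, (p.1 : V3)⟫_ℝ • (p.1 : V3)‖ ^ 2 ≤ (1 + ‖v‖ ^ 2) * (1 + ‖p.2‖ ^ 2) := by
            nlinarith [sq_nonneg ‖v‖, sq_nonneg ‖p.2‖, mul_nonneg (sq_nonneg ‖v‖) (sq_nonneg ‖p.2‖)]
          calc _ ≤ max ⟪v - p.2, (p.1 : V3)⟫_ℝ 0 * globalMaxwellian p.2 * ((1 + ‖v‖ ^ 2) * (1 + ‖p.2‖ ^ 2)) :=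
                mul_le_mul_of_nonneg_left h2 hq0
            _ = _ := by ring
      _ = (1 + ‖v‖ ^ 2) * ∫ p : Metric.sphere (0 : V3) 1 × V3,
            max ⟪v - p.2, (p.1 : V3)⟫_ℝ 0 * globalMaxwellian p.2 * (1 + ‖p.2‖ ^ 2)
          ∂((sphereMeasure : Measure (Metric.sphere (0 : V3) 1)).prod volume) := integral_const_mul _ _
      _ ≤ (1 + ‖v‖ ^ 2) * (4 * Real.pi * (4 * ‖v‖ + 9)) := mul_le_mul_of_nonneg_left hbud (by positivity)
  -- the moments of the critical weight
  obtain ⟨hm, -, ⟨hi3, hI3⟩, -⟩ := k2r_ref_R3_facts hR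
  obtain ⟨hi0, hv0⟩ := hm 0 (by norm_num)
  obtain ⟨hi1, hv1⟩ := hm 1 (by norm_num)
  obtain ⟨hi2, hv2⟩ := hm 2 (by norm_num)
  have hθ0 : ∀ v : V3, 0 ≤ Θ₀ R v := fun v => by rw [hΘ₀]; positivity
  have heval : ∀ v : V3, Θ₀ R v * ((1 + ‖v‖ ^ 2) * (4 * Real.pi * (4 * ‖v‖ + 9))) =
      4 * Real.pi * (4 * (‖v‖ ^ 1 * (((1 + ‖v‖ ^ 2) ^ 3)⁻¹ * Real.exp (-‖v‖ ^ 2 / R))) +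
        9 * (‖v‖ ^ 0 * (((1 + ‖v‖ ^ 2) ^ 3)⁻¹ * Real.exp (-‖v‖ ^ 2 / R))) +
        4 * (‖v‖ ^ 3 * (((1 + ‖v‖ ^ 2) ^ 3)⁻¹ * Real.exp (-‖v‖ ^ 2 / R))) +
        9 * (‖v‖ ^ 2 * (((1 + ‖v‖ ^ 2) ^ 3)⁻¹ * Real.exp (-‖v‖ ^ 2 / R)))) := fun v => by
    rw [hΘ₀]; ring
  have iA : Integrable (fun v : V3 => 4 * (‖v‖ ^ 1 * (((1 + ‖v‖ ^ 2) ^ 3)⁻¹ * Real.exp (-‖v‖ ^ 2 / R)))) := hi1.const_mul 4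
  have iB : Integrable (fun v : V3 => 9 * (‖v‖ ^ 0 * (((1 + ‖v‖ ^ 2) ^ 3)⁻¹ * Real.exp (-‖v‖ ^ 2 / R)))) := hi0.const_mul 9
  have iC : Integrable (fun v : V3 => 4 * (‖v‖ ^ 3 * (((1 + ‖v‖ ^ 2) ^ 3)⁻¹ * Real.exp (-‖v‖ ^ 2 / R)))) := hi3.const_mul 4
  have iD : Integrable (fun v : V3 => 9 * (‖v‖ ^ 2 * (((1 + ‖v‖ ^ 2) ^ 3)⁻¹ * Real.exp (-‖v‖ ^ 2 / R)))) := hi2.const_mul 9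
  have iAB : Integrable (fun v : V3 => 4 * (‖v‖ ^ 1 * (((1 + ‖v‖ ^ 2) ^ 3)⁻¹ * Real.exp (-‖v‖ ^ 2 / R))) +
      9 * (‖v‖ ^ 0 * (((1 + ‖v‖ ^ 2) ^ 3)⁻¹ * Real.exp (-‖v‖ ^ 2 / R)))) := iA.add iB
  have iABC : Integrable (fun v : V3 => 4 * (‖v‖ ^ 1 * (((1 + ‖v‖ ^ 2) ^ 3)⁻¹ * Real.exp (-‖v‖ ^ 2 / R))) +
      9 * (‖v‖ ^ 0 * (((1 + ‖v‖ ^ 2) ^ 3)⁻¹ * Real.exp (-‖v‖ ^ 2 / R))) +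
      4 * (‖v‖ ^ 3 * (((1 + ‖v‖ ^ 2) ^ 3)⁻¹ * Real.exp (-‖v‖ ^ 2 / R)))) := iAB.add iC
  calc ∫ v : V3, Θ₀ R v * ∫ p : Metric.sphere (0 : V3) 1 × V3,
          max ⟪v - p.2, (p.1 : V3)⟫_ℝ 0 * globalMaxwellian p.2 *
            (1 + ‖p.2 + ⟪v - p.2, (p.1 : V3)⟫_ℝ • (p.1 : V3)‖ ^ 2)
          ∂((sphereMeasure : Measure (Metric.sphere (0 : V3) 1)).prod volume)
      ≤ ∫ v : V3, Θ₀ R v * ((1 + ‖v‖ ^ 2) * (4 * Real.pi * (4 * ‖v‖ + 9))) := by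
        refine integral_mono hint ((iABC.add iD).const_mul (4 * Real.pi) |>.congr
          (Eventually.of_forall fun v => (heval v).symm)) fun v => ?_
        exact mul_le_mul_of_nonneg_left (hflux v) (hθ0 v)
    _ = 4 * Real.pi * (4 * (∫ v : V3, ‖v‖ ^ 1 * (((1 + ‖v‖ ^ 2) ^ 3)⁻¹ * Real.exp (-‖v‖ ^ 2 / R))) +
          9 * (∫ v : V3, ‖v‖ ^ 0 * (((1 + ‖v‖ ^ 2) ^ 3)⁻¹ * Real.exp (-‖v‖ ^ 2 / R))) +
          4 * (2 * Real.pi * ∫ E in Ioi (0 : ℝ), E ^ 2 * (((1 + E) ^ 3)⁻¹ * Real.exp (-E / R))) +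
          9 * ∫ v : V3, ‖v‖ ^ 2 * (((1 + ‖v‖ ^ 2) ^ 3)⁻¹ * Real.exp (-‖v‖ ^ 2 / R))) := by
        rw [integral_congr_ae (Eventually.of_forall heval), integral_const_mul, integral_add iABC iD,
          integral_add iAB iC, integral_add iA iB, integral_const_mul, integral_const_mul, integral_const_mul,
          integral_const_mul, hI3]
    _ ≤ _ := by nlinarith [Real.pi_pos, hv0, hv1, hv2, Real.pi_gt_three]
end Summit.AtomisticToContinuum.HydrodynamicLimit.Theorems.EnskogAdjointDuality
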